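import Summits.AtomisticToContinuum.BoseEinsteinCondensation.Theorems.SoloInformedRigidityBound
import Literature.MathematicalPhysics.QuantumManyBody.BoseGasFreeProductState
import Literature.MathematicalPhysics.QuantumManyBody.BoseGasThermodynamicLimitRuelle

/-!
# The condensate number is a genuine particle number: `λ_max(γ_Ψ) ≤ N`, `condensateNumber ≤ N`

Conjunct `BoseEinsteinCondensation` of `AtomisticToContinuum` — statement audit (soloist report
`paper/sharpest.md` §1, claim C1). The audited statement asks for `c N ≤ condensateNumber v N L_N`
eventually, where `condensateNumber = sup_{δ>0} inf_{δ-near-minimisers Ψ} λ_max(γ_Ψ)` and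
`λ_max(γ_Ψ) = sup_{‖φ‖₂ = 1} ⟨φ, γ_Ψ φ⟩`. Two junk-value loopholes have to be excluded for this to be
the intended assertion: (a) `λ_max(γ_Ψ)` could a priori exceed `N` (an `ℝ≥0∞` supremum of Bochner
overlaps), and (b) the infimum over near-minimisers could run over the empty type (`⊤`), making
`c N ≤ ⊤` vacuous. This file closes both, sorry-free:

* `SoloInformed.maxOccupation_le` — for every measurable `Ψ : (ℝ³)^N → ℂ`,
  `λ_max(γ_Ψ) ≤ N ∫ |Ψ|²` (Cauchy–Schwarz on each slice + Tonelli; the `S = univ` instance of the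
  conditional-confinement bound `SoloInformed.maxOccupation_le_of_confined`), hence `≤ N` for a
  normalised trial state (`SoloInformed.maxOccupation_trialState_le`);
* `SoloInformed.condensateNumber_le` — if the box admits at least one trial state then
  `condensateNumber v N L ≤ N` (near-minimisers exist for every slack `δ > 0`);
* `SoloInformed.condensateNumber_le_eventually` — at every density `ρ > 0`, for all large `N`,
  `condensateNumber v N (N/ρ)^{1/3} ≤ N < ⊤` (trial states in large boxes exist:
  `exists_freeProductState` [LSSY2005, Ch. 2 (2.3)]);
* `SoloInformed.condensateFraction_le_one` — consequently any constant `c` witnessing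
  `HasGroundStateBEC v ρ` satisfies `c ≤ 1`: the statement's `c` is a condensate FRACTION, and the
  inequality it asks for is never satisfied by a junk `⊤`.

References: [LSSY2005] Lieb–Seiringer–Solovej–Yngvason, *The Mathematics of the Bose Gas and its
Condensation* (2005), §1.2 (1.17)–(1.19) (`0 ≤ γ ≤ N` as an operator, `tr γ = N`).
-/

noncomputable section

open MeasureTheory Filter Set
open scoped ENNReal NNReal

namespace Summit.AtomisticToContinuum.BoseEinsteinCondensation.Theorems

open Literature.MathematicalPhysics.QuantumManyBody.BoseGas

variable {n : ℕ}

/-- **`λ_max(γ_Ψ) ≤ N ‖Ψ‖₂²`.** For every measurable `Ψ : (ℝ³)^{n+1} → ℂ`,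
`sup_{‖φ‖₂=1} ⟨φ, γ_Ψ φ⟩ ≤ (n+1) ∫ |Ψ|²` (Cauchy–Schwarz `|∫ conj(φ) Ψ(·, X̂)|² ≤ ∫|Ψ(·, X̂)|²` on each
slice, then Tonelli). [cite: LSSY2005, §1.2 (1.17)–(1.18)] -/
theorem SoloInformed.maxOccupation_le {Ψ : Config (n + 1) → ℂ} (hΨ : Measurable Ψ) :
    maxOccupation (n + 1) Ψ ≤ (n + 1 : ℝ≥0∞) * ∫⁻ X, (‖Ψ X‖₊ : ℝ≥0∞) ^ 2 := by
  refine SoloInformed.maxOccupation_le_of_confined hΨ MeasurableSet.univ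
    (fun x Y h => absurd (Set.mem_univ _) h) fun x => ?_
  simp only [Set.indicator_univ, Pi.one_apply, one_mul]
  exact (lintegral_lintegral_sq_nnnorm_vecCons hΨ).le

/-- **`λ_max(γ_Ψ) ≤ N` for a normalised trial state.** [cite: LSSY2005, §1.2 (1.17)–(1.18)] -/
theorem SoloInformed.maxOccupation_trialState_le {L : ℝ} (Ψ : TrialState (n + 1) L) :
    maxOccupation (n + 1) Ψ.ψ ≤ (n + 1 : ℝ≥0∞) := by
  simpa [Ψ.norm_eq] using SoloInformed.maxOccupation_le Ψ.contDiff.continuous.measurable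

/-- **`condensateNumber ≤ N` whenever the box admits a trial state.** For every slack `δ > 0` a
`δ`-near-minimiser exists (any trial state if `E₀ = ⊤`, else by the definition of the infimum), and
its `λ_max` is at most `N`. [cite: LSSY2005, §1.2 (1.19)] -/
theorem SoloInformed.condensateNumber_le (v : ℝ → ℝ≥0∞) {L : ℝ} (Φ : TrialState (n + 1) L) :
    condensateNumber v (n + 1) L ≤ (n + 1 : ℝ≥0∞) := by
  simp only [condensateNumber, iSup_le_iff]
  intro δ hδ
  -- a `δ`-near-minimiser
  obtain ⟨Ψ, hΨ⟩ : ∃ Ψ : TrialState (n + 1) L,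
      energy v Ψ ≤ groundStateEnergy v (n + 1) L + δ := by
    by_cases htop : groundStateEnergy v (n + 1) L = ⊤
    · exact ⟨Φ, by simp [htop]⟩
    · have hlt : groundStateEnergy v (n + 1) L < groundStateEnergy v (n + 1) L + δ :=
        ENNReal.lt_add_right htop hδ.ne'
      obtain ⟨Ψ, hΨ⟩ := iInf_lt_iff.1 hlt
      exact ⟨Ψ, hΨ.le⟩
  exact (iInf_maxOccupation_le v Ψ hΨ).trans (SoloInformed.maxOccupation_trialState_le Ψ)

/-- **Non-vacuity in the thermodynamic limit.** At every density `ρ > 0`, for all large `N` the box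
`Λ_{L_N}`, `L_N = (N/ρ)^{1/3}`, admits trial states (free product states, [LSSY2005, Ch. 2 (2.3)]), so
`condensateNumber v N L_N ≤ N`; in particular it is finite and `c N ≤ condensateNumber` is a genuine
constraint (`L_N → ∞`: `tendsto_sideLength_atTop`). [cite: LSSY2005, §1.2 (1.19); Ch. 2 (2.3)] -/
theorem SoloInformed.condensateNumber_le_eventually (v : ℝ → ℝ≥0∞) {ρ : ℝ} (hρ : 0 < ρ) :
    ∀ᶠ N : ℕ in atTop, condensateNumber v N (sideLength ρ N) ≤ (N : ℝ≥0∞) := by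
  obtain ⟨L₀, -, hL₀⟩ := exists_freeProductState one_pos
  filter_upwards [(tendsto_sideLength_atTop hρ).eventually_ge_atTop L₀,
    eventually_ge_atTop 1] with N hN hN1
  obtain ⟨n, rfl⟩ : ∃ n, N = n + 1 := ⟨N - 1, (Nat.sub_add_cancel hN1).symm⟩
  obtain ⟨Φ, -⟩ := hL₀ _ hN (n + 1)
  simpa using SoloInformed.condensateNumber_le v Φ

/-- **The BEC constant is a fraction.** If `c N ≤ condensateNumber v N L_N` for all large `N` at a
density `ρ > 0` (the inequality asked for by `HasGroundStateBEC v ρ`), then `c ≤ 1`.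
[cite: LSSY2005, §1.2 (1.19)] -/
theorem SoloInformed.condensateFraction_le_one (v : ℝ → ℝ≥0∞) {ρ : ℝ} (hρ : 0 < ρ) {c : ℝ}
    (h : ∀ᶠ N : ℕ in atTop, ENNReal.ofReal (c * N) ≤ condensateNumber v N (sideLength ρ N)) :
    c ≤ 1 := by
  rw [← not_lt]
  intro hc
  have hev := (h.and (SoloInformed.condensateNumber_le_eventually v hρ)).and (eventually_ge_atTop 1)
  obtain ⟨N, ⟨hcN, hNle⟩, hN1⟩ := hev.exists
  have hle : ENNReal.ofReal (c * N) ≤ (N : ℝ≥0∞) := hcN.trans hNle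
  have hN : (0 : ℝ) < N := by exact_mod_cast hN1
  have : c * N ≤ N := by
    have := (ENNReal.ofReal_le_iff_le_toReal (by simp)).1 hle
    simpa using this
  nlinarith

/-- **`HasGroundStateBEC` constants are fractions** (packaged form). [cite: LSSY2005, §1.2 (1.19)] -/
theorem SoloInformed.hasGroundStateBEC_const_le_one (v : ℝ → ℝ≥0∞) {ρ : ℝ} (hρ : 0 < ρ)
    (h : HasGroundStateBEC v ρ) : ∃ c : ℝ, 0 < c ∧ c ≤ 1 ∧
      ∀ᶠ N : ℕ in atTop, ENNReal.ofReal (c * N) ≤ condensateNumber v N (sideLength ρ N) := by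
  obtain ⟨c, hc, hN⟩ := h
  exact ⟨c, hc, SoloInformed.condensateFraction_le_one v hρ hN, hN⟩

end Summit.AtomisticToContinuum.BoseEinsteinCondensation.Theorems
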